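import Summits.NavierStokesRegularity.NavierStokesRegularity.Theorems.StrainDoorsNearFieldFarIBP
import Summits.NavierStokesRegularity.NavierStokesRegularity.Theorems.StrainDoorsNearFieldEnergy
import HarnessLib

/-!
# StrainDoorsNearFieldFarEnergy — ★ atom A2♭ PROVED: `farFieldEnergyBound_holds : FarFieldEnergyBound`

ROUND-43/44 door D7♭ `NearFieldSubParityDoor` (nsreg-p1 g33, `Theorems/StrainDoorsNearFieldDefs`); atom A2♭ asks for ONE
constant `C ≥ 0` with `|farQuadS r u t x e| ≤ (C/r⁵)·E(u(t))` for every solution of the door frame, every `t ∈ [0,T)`,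
`r > 0`, `x`, unit `e`. Assembly of the kernel half (`Theorems/StrainDoorsNearFieldKernel`: `‖D²[(1−χ_r)K_e]‖ ≤ C₂/r⁵`)
and the double integration by parts (`Theorems/StrainDoorsNearFieldFarIBP`:
`farQuadS = −Σᵢⱼ ∫ ∂ⱼ∂ᵢG(z−x)·vⱼvᵢ dz`): `|farQuadS| ≤ 9·(C₂/r⁵)·∫|v|² = (18C₂/r⁵)·E(v)`; the frame (smooth slices,
divergence free, all Sobolev norms bounded on closed sub-slabs) supplies `v = u(t) ∈ C^∞`, `div v = 0` and
`v, ∇v, ∇²v ∈ L²`. With the LEAD/p1 ledger this closes plate F♭ `FarFieldUniformBound` (`farFieldUniformBound_of_energyBound`)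
and leaves door D7♭ resting on the single atom A1♭ (`nearFieldSubParityDoor_of_A1_A2`).
Everything proved; no named facts; `--supports stmt-NavierStokesRegularity-0056 --as helper` (ns-s29-p2 g5; LEAD S-door ns-s30-p1 g4
key «A2♭», 2026-08-28T23:36:24Z).

HONEST FRAME: one true analytic atom of a CONDITIONAL regularity criterion (D7♭); items 0056 `NoTypeII`, 10661 and NS
regularity are NOT proved; nothing here is a route or a summit statement.
-/

noncomputable section

open MeasureTheory Set Function Filter Metric Real InnerProductSpace
open _root_.Topology
open scoped RealInnerProductSpace ContDiff ENNReal NNReal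
open Literature.Analysis Literature.Analysis.FluidPDE

set_option linter.dupNamespace false

namespace Summit.NavierStokesRegularity.NavierStokesRegularity.Theorems.StrainDoors

/-! ## §1 The far-field bound for one slice -/

/-- **`|farQuadS_r| ≤ (9C₂/r⁵)·‖v‖₂²`** for a smooth divergence-free slice `v = u(t)` with `v, ∇v, ∇²v ∈ L²` (one constant for
all `r > 0`, unit `e`, `x`, `u`, `t`). -/
theorem exists_abs_farQuadS_le :
    ∃ C : ℝ, 0 ≤ C ∧ ∀ (r : ℝ), 0 < r → ∀ (e : EuclideanSpace ℝ (Fin 3)), ‖e‖ = 1 →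
      ∀ (u : ℝ → (EuclideanSpace ℝ (Fin 3)) → (EuclideanSpace ℝ (Fin 3))) (t : ℝ),
        ContDiff ℝ ∞ (u t) → VectorCalculus.IsDivFree (u t) → Integrable (fun z => ‖u t z‖ ^ 2) →
        Integrable (fun z => ‖fderiv ℝ (u t) z‖ ^ 2) → Integrable (fun z => ‖iteratedFDeriv ℝ 2 (u t) z‖ ^ 2) →
        ∀ x : EuclideanSpace ℝ (Fin 3), |farQuadS r u t x e| ≤ C / r ^ 5 * ∫ z, ‖u t z‖ ^ 2 := by
  obtain ⟨C₂, hC₂0, hC₂⟩ := exists_norm_iteratedFDeriv_farKernel_le (n := 2) le_rfl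
  refine ⟨9 * C₂, by positivity, fun r hr e he u t hv hdiv hL2 hD hD2 x => ?_⟩
  set b := EuclideanSpace.basisFun (Fin 3) ℝ with hb
  have hb1 : ∀ i, ‖b i‖ = 1 := fun i => b.orthonormal.1 i
  rw [farQuadS_eq_neg_sum_integral_hessian_mul hr he hv hdiv hL2 hD hD2 x, abs_neg]
  -- the integrand of each term is dominated by `(C₂/r⁵)·‖v‖²`
  have hdom : ∀ i j z,
      |fderiv ℝ (fun z => fderiv ℝ (fun z => farKernel r e (z - x)) z (b i)) z (b j) * (⟪u t z, b j⟫ * ⟪u t z, b i⟫)| ≤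
        C₂ / r ^ 5 * ‖u t z‖ ^ 2 := fun i j z => by
    rw [abs_mul, abs_mul]
    have h1 := (abs_fderiv_fderiv_farKernel_sub_le hr e x z (b i) (b j) (hb1 i) (hb1 j)).trans (hC₂ r hr e he _)
    have h2 : |⟪u t z, b j⟫| ≤ ‖u t z‖ := by simpa [hb1 j] using abs_real_inner_le_norm (u t z) (b j)
    have h3 : |⟪u t z, b i⟫| ≤ ‖u t z‖ := by simpa [hb1 i] using abs_real_inner_le_norm (u t z) (b i)
    have h23 : |⟪u t z, b j⟫| * |⟪u t z, b i⟫| ≤ ‖u t z‖ ^ 2 := by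
      calc |⟪u t z, b j⟫| * |⟪u t z, b i⟫| ≤ ‖u t z‖ * ‖u t z‖ := mul_le_mul h2 h3 (abs_nonneg _) (norm_nonneg _)
        _ = ‖u t z‖ ^ 2 := (sq _).symm
    have h5 : C₂ / r ^ (3 + 2) = C₂ / r ^ 5 := by norm_num
    rw [h5] at h1
    exact mul_le_mul h1 h23 (mul_nonneg (abs_nonneg _) (abs_nonneg _)) (by positivity)
  have hint : Integrable fun z => C₂ / r ^ 5 * ‖u t z‖ ^ 2 := hL2.const_mul _
  have hterm : ∀ i j,
      |∫ z, fderiv ℝ (fun z => fderiv ℝ (fun z => farKernel r e (z - x)) z (b i)) z (b j) *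
          (⟪u t z, b j⟫ * ⟪u t z, b i⟫)| ≤ C₂ / r ^ 5 * ∫ z, ‖u t z‖ ^ 2 := fun i j => by
    refine abs_integral_le_integral_abs.trans ?_
    rw [← integral_const_mul]
    exact integral_mono_of_nonneg (Eventually.of_forall fun z => abs_nonneg _) hint
      (Eventually.of_forall fun z => hdom i j z)
  calc |∑ i, ∑ j, ∫ z, fderiv ℝ (fun z => fderiv ℝ (fun z => farKernel r e (z - x)) z (b i)) z (b j) *
          (⟪u t z, b j⟫ * ⟪u t z, b i⟫)|
      ≤ ∑ i, |∑ j, ∫ z, fderiv ℝ (fun z => fderiv ℝ (fun z => farKernel r e (z - x)) z (b i)) z (b j) *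
          (⟪u t z, b j⟫ * ⟪u t z, b i⟫)| := Finset.abs_sum_le_sum_abs _ _
    _ ≤ ∑ i, ∑ j, |∫ z, fderiv ℝ (fun z => fderiv ℝ (fun z => farKernel r e (z - x)) z (b i)) z (b j) *
          (⟪u t z, b j⟫ * ⟪u t z, b i⟫)| := Finset.sum_le_sum fun i _ => Finset.abs_sum_le_sum_abs _ _
    _ ≤ ∑ _i : Fin 3, ∑ _j : Fin 3, C₂ / r ^ 5 * ∫ z, ‖u t z‖ ^ 2 :=
        Finset.sum_le_sum fun i _ => Finset.sum_le_sum fun j _ => hterm i j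
    _ = 9 * C₂ / r ^ 5 * ∫ z, ‖u t z‖ ^ 2 := by
        simp only [Finset.sum_const, Finset.card_univ, Fintype.card_fin, nsmul_eq_mul]
        push_cast
        ring

/-! ## §2 The frame supplies the hypotheses -/

/-- in the door frame every Sobolev density `‖Dⁿu(t,·)‖²` is integrable at every `t ∈ [0,T)`. -/
theorem integrable_sq_norm_iteratedFDeriv_of_frame {ν T : ℝ}
    {u : ℝ → (EuclideanSpace ℝ (Fin 3)) → (EuclideanSpace ℝ (Fin 3))} {p : ℝ → (EuclideanSpace ℝ (Fin 3)) → ℝ}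
    (hsol : IsClassicalNSSolutionOn (Ico 0 T) ν 0 u p) (hSob : ∀ T'' < T, HasBoundedSobolevNormsOn (Icc 0 T'') u)
    {t : ℝ} (ht : t ∈ Ico 0 T) (n : ℕ) : Integrable (fun z => ‖iteratedFDeriv ℝ n (u t) z‖ ^ 2) := by
  have hsm : ContDiff ℝ n (u t) := contDiff_infty.1 (hsol.contDiff_velocity ht) n
  have hc : Continuous fun z => ‖iteratedFDeriv ℝ n (u t) z‖ ^ 2 :=
    ((hsm.continuous_iteratedFDeriv le_rfl).norm).pow 2
  obtain ⟨C, hC⟩ := hSob t ht.2 n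
  have hfin : ∫⁻ z, ‖(‖iteratedFDeriv ℝ n (u t) z‖ ^ 2)‖ₑ < ⊤ := by
    have h1 : ∀ z, ‖(‖iteratedFDeriv ℝ n (u t) z‖ ^ 2)‖ₑ = ‖iteratedFDeriv ℝ n (u t) z‖ₑ ^ 2 := fun z => by
      rw [Real.enorm_eq_ofReal (sq_nonneg _), ENNReal.ofReal_pow (norm_nonneg _), ofReal_norm]
    simp_rw [h1]
    exact lt_of_le_of_lt (hC t ⟨ht.1, le_rfl⟩) ENNReal.coe_lt_top
  exact ⟨hc.aestronglyMeasurable, hfin⟩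

/-- in the door frame: `u(t) ∈ L²`. -/
theorem integrable_sq_norm_of_frame {ν T : ℝ}
    {u : ℝ → (EuclideanSpace ℝ (Fin 3)) → (EuclideanSpace ℝ (Fin 3))} {p : ℝ → (EuclideanSpace ℝ (Fin 3)) → ℝ}
    (hsol : IsClassicalNSSolutionOn (Ico 0 T) ν 0 u p) (hSob : ∀ T'' < T, HasBoundedSobolevNormsOn (Icc 0 T'') u)
    {t : ℝ} (ht : t ∈ Ico 0 T) : Integrable (fun z => ‖u t z‖ ^ 2) := by
  have h := integrable_sq_norm_iteratedFDeriv_of_frame hsol hSob ht 0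
  simp only [norm_iteratedFDeriv_zero] at h
  exact h

/-- in the door frame: `∇u(t) ∈ L²` (operator norm). -/
theorem integrable_sq_norm_fderiv_of_frame {ν T : ℝ}
    {u : ℝ → (EuclideanSpace ℝ (Fin 3)) → (EuclideanSpace ℝ (Fin 3))} {p : ℝ → (EuclideanSpace ℝ (Fin 3)) → ℝ}
    (hsol : IsClassicalNSSolutionOn (Ico 0 T) ν 0 u p) (hSob : ∀ T'' < T, HasBoundedSobolevNormsOn (Icc 0 T'') u)
    {t : ℝ} (ht : t ∈ Ico 0 T) : Integrable (fun z => ‖fderiv ℝ (u t) z‖ ^ 2) := by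
  have h := integrable_sq_norm_iteratedFDeriv_of_frame hsol hSob ht 1
  simp only [norm_iteratedFDeriv_one] at h
  exact h

/-! ## §3 The atom -/

/-- ★ **atom A2♭ «FarFieldEnergyBound» PROVED**: one universal constant `C ≥ 0` with
`|farQuadS r u t x e| ≤ (C/r⁵)·E(u(t))` in the door frame (`E = ½∫|u|²`). -/
theorem farFieldEnergyBound_holds : FarFieldEnergyBound := by
  obtain ⟨C, hC0, hC⟩ := exists_abs_farQuadS_le
  refine ⟨2 * C, by positivity, fun ν T u p _hν hsol hSob t ht r hr x e he => ?_⟩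
  have h := hC r hr e he u t (hsol.contDiff_velocity ht) (hsol.divFree t ht) (integrable_sq_norm_of_frame hsol hSob ht)
    (integrable_sq_norm_fderiv_of_frame hsol hSob ht) (integrable_sq_norm_iteratedFDeriv_of_frame hsol hSob ht 2) x
  have hE : ∫ z, ‖u t z‖ ^ 2 = 2 * VectorCalculus.kineticEnergy (u t) := by
    unfold VectorCalculus.kineticEnergy
    ring
  rw [hE] at h
  calc |farQuadS r u t x e| ≤ C / r ^ 5 * (2 * VectorCalculus.kineticEnergy (u t)) := h
    _ = 2 * C / r ^ 5 * VectorCalculus.kineticEnergy (u t) := by ring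

/-- ★ hence PLATE F♭ and door D7♭ from A1♭ alone (by the LEAD/p1 ledger, `nearFieldSubParityDoor_of_A1_A2`). -/
theorem nearFieldSubParityDoor_of_A1 (h1 : NewtonHessianFormulaSmooth) : NearFieldSubParityDoor :=
  nearFieldSubParityDoor_of_A1_A2 h1 farFieldEnergyBound_holds

end Summit.NavierStokesRegularity.NavierStokesRegularity.Theorems.StrainDoors

end
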